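import Literature.AlgebraicGeometry.Motives.SeesawRelativeSubschemeReprIdeal
import Literature.AlgebraicGeometry.Modules.RankOneDescentAlongH0Iso
import Literature.AlgebraicGeometry.Motives.WhiskerLeftPullback
import Literature.AlgebraicGeometry.Motives.PushforwardStructureSheaf
import Literature.AlgebraicGeometry.Modules.PullbackQuasicoherent
import HarnessLib

/-!
# RELATIVE EDITION (ring base `R`) — The seesaw closed subscheme: «trivialised from the base» is local on the test scheme (`N1cDelta`)

RELATIVE EDITION of ★ `Motives/SeesawTrivFromBaseLocal` (port map `B-provers/B-p08/g11/PORTMAP-h8-RelativeSeesaw.B-p08g11.md`, file R8;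
cell `hodgecm-mathlib`, F-DAG §5b hand (h8), author B-p08 (g11)): `SchemeOver ℂ ↦ SchemeOver R`, Stein as the hypothesis
`hSt : UnivStein X` (★ `SeesawRelativeChartSections`) (the descent of transition functions along `pr_S♯` uses `hSt` instead of ★ `snd_app_bijective_holds`); namespace `Literature.AlgebraicGeometry.Motives.SeesawRelative`.
HC_CM is proved only modulo the 7 printed citations until rung 0 closes.  Original module docstring (with `ℂ` read as `R`):


[MumfordAV1970] §5 Cor. 6 and §10 (p. 89) / [GortzWedhorn2023] Lemma 24.67: for `X/ℂ` proper and geometrically integral,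
`𝓕` quasi-coherent of rank one on `X × W` and a test morphism `u : S → W`, if every point of `S` has an open
neighbourhood `V` with `(1 × u|_V)^*𝓕 ≅ pr_V^*𝓜_V` for a rank-one `𝓜_V`, then `(1 × u)^*𝓕 ≅ pr_S^*𝓜` for a rank-one
quasi-coherent `𝓜` on `S`: the local trivialisations give rank-one frames of `(1 × u)^*𝓕` over the preimages `pr_S⁻¹V′`
of an open cover (`exists_frame_over_preimage_of_trivFromBase`), whose transition functions descend along
`pr_S♯ : Γ(V, 𝒪_S) ⥲ Γ(X × V, 𝒪)` (★ `snd_app_bijective_holds`) to a cocycle on `S`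
(★ `Modules.exists_iso_pullback_of_frames_over_preimages`).  HEAD **`n1cDelta_holds : N1cDelta`** (the statement of
`SeesawSubschemeReprIdeal`).  Author of the mathematics and of the Lean text: B-p15 (g8), HOME
`B-plan/m13-glue/N1cDelta-TrivFromBaseLocal.v2.B-p15g8.lean` e17e39d27160446e §B, decls token-identical (its §0 = the two
definitions, now imported); filed in the N1 chain of cell `hodgecm-mathlib` (M13 node N1, file S2b).

## References
* [MumfordAV1970] D. Mumford, *Abelian Varieties* (1970), §5 Cor. 6, §10 p. 89.
* [GortzWedhorn2023] U. Görtz, T. Wedhorn, *Algebraic Geometry II* (2023), Lemma 24.67.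
-/

set_option autoImplicit false

noncomputable section

universe u

open CategoryTheory CategoryTheory.Limits AlgebraicGeometry TopologicalSpace Opposite

namespace Literature.AlgebraicGeometry.Motives

open MonoidalCategory CartesianMonoidalCategory

open SeesawRelative

/-! ## The adapter: from a local trivialisation to a frame over `pr_S⁻¹V′`, and the discharge -/

namespace SeesawRelative

variable {R : Type} [CommRing R] (X : SchemeOver R) {W : SchemeOver R} (𝓕 : (X ⊗ W).left.Modules)

/-- **`X ×_B T′ ≅ (X ×_B T) ×_T T′` over ANY base scheme `B`**: the square `(X ◁ f, pr_{T′}; pr_T, f)` of the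
cartesian-monoidal `Over B` is cartesian ([GortzWedhorn2020] Prop. 4.16; the tree's ★ `isPullback_whiskerLeft_snd` is the
case `B = Spec K`, `K` a field — same proof, base generalised). [cite: GortzWedhorn2020, Prop. 4.16 (p. 101)] -/
theorem isPullback_whiskerLeft_snd_over {B : Scheme.{0}} (X : Over B) {T T' : Over B} (f : T' ⟶ T) :
    IsPullback (X ◁ f).left (snd X T').left (snd X T).left f.left := by
  have big : IsPullback ((X ◁ f).left ≫ (fst X T).left) (snd X T').left X.hom (f.left ≫ T.hom) := by
    have e₁ : (X ◁ f).left ≫ (fst X T).left = (fst X T').left := by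
      rw [← Over.comp_left, whiskerLeft_fst]
    have e₂ : f.left ≫ T.hom = T'.hom := Over.w f
    rw [e₁, e₂]
    exact IsPullback.of_hasPullback X.hom T'.hom
  have comm : (X ◁ f).left ≫ (snd X T).left = (snd X T').left ≫ f.left := by
    rw [← Over.comp_left, whiskerLeft_snd, Over.comp_left]
  exact IsPullback.of_right big comm (IsPullback.of_hasPullback X.hom T.hom)

/-- **From a local trivialisation from the base to a rank-one frame of `(1 × u)^*𝓕` over a preimage
`pr_S⁻¹V′`, `V′ ∋ s`.**  If `(1 × u|_V)^*𝓕 ≅ pr_V^*𝓜` with `𝓜` of rank one on `V ∋ s`, then for a smaller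
`V′ ∋ s` on which `𝓜` is free, `(1 × u)^*𝓕` is free of rank one over `pr_S⁻¹V′ = X × V′` (transport
along `X × V′ ≅ pr_S⁻¹V′`, ★ `isPullback_whiskerLeft_snd`). [cite: MumfordAV1970, §10 (p. 89)] -/
theorem exists_frame_over_preimage_of_trivFromBase {S : SchemeOver R} (u : S ⟶ W) (V : S.left.Opens)
    (uV : Over.mk (V.ι ≫ S.hom) ⟶ W) (huV : uV.left = V.ι ≫ u.left) (hV : SeesawRelative.TrivFromBase X 𝓕 uV)
    (s : S.left) (hs : s ∈ V) :
    ∃ V' : S.left.Opens, s ∈ V' ∧ ∃ (I : Type) (_ : I ≃ Fin 1),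
      Nonempty (SheafOfModules.free I ≅
        ((Scheme.Modules.pullback (X ◁ u).left).obj 𝓕).over ((snd X S).left ⁻¹ᵁ V')) := by
  obtain ⟨𝓜, -, h𝓜, ⟨eV⟩⟩ := hV
  -- (1) a frame of `𝓜` near `s`, made global on the open `O ∋ s` of `V`
  obtain ⟨FM, hFM⟩ := Modules.exists_frameSystem_of_hasRank h𝓜
  let s' : (V : Scheme.{0}) := ⟨s, hs⟩
  let O : (V : Scheme.{0}).Opens := FM.U s'
  let I : Type := FM.I s'
  let ε : I ≃ Fin 1 := (FM.enum s').trans (finCongr (hFM s'))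
  obtain ⟨e0⟩ := KTheory.nonempty_restrictIso_of_overIso (FM.frame s')
  -- `e1 : O.ι^* 𝓜 ≅ 𝒪^I` on `O`
  let e1 : (Scheme.Modules.pullback O.ι).obj 𝓜 ≅ SheafOfModules.free I :=
    ((Scheme.Modules.restrictFunctorIsoPullback O.ι).app 𝓜).symm ≪≫ e0.symm
  -- (2) the open `V' := V.ι(O)` of `S` and `λ : V' → V`
  let V' : S.left.Opens := V.ι ''ᵁ O
  have hsV' : s ∈ V' := ⟨s', FM.mem s', rfl⟩
  let α : (O : Scheme.{0}) ≅ (V' : Scheme.{0}) := V.ι.isoImage O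
  let lam : (V' : Scheme.{0}) ⟶ (V : Scheme.{0}) := α.inv ≫ O.ι
  have hlam : lam ≫ V.ι = V'.ι := by
    rw [Category.assoc]; exact V.ι.isoImage_inv_ι O
  obtain ⟨e2a⟩ := KTheory.nonempty_pullbackFreeIso α.inv I
  let e2 : (Scheme.Modules.pullback lam).obj 𝓜 ≅ SheafOfModules.free I :=
    ((Scheme.Modules.pullbackComp α.inv O.ι).app 𝓜).symm ≪≫
      (Scheme.Modules.pullback α.inv).mapIso e1 ≪≫ e2a
  -- (3) the test scheme `V'° = (V' → Spec ℂ)` and `κ : V'° ⟶ V°`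
  let V'o : SchemeOver R := Over.mk (V'.ι ≫ S.hom)
  let κ : V'o ⟶ Over.mk (V.ι ≫ S.hom) := Over.homMk lam (by
    change lam ≫ V.ι ≫ S.hom = V'.ι ≫ S.hom
    rw [← Category.assoc, hlam])
  have hsq : (X ◁ κ).left ≫ (snd X (Over.mk (V.ι ≫ S.hom))).left = (snd X V'o).left ≫ lam := by
    rw [← Over.comp_left, whiskerLeft_snd, Over.comp_left]
    rfl
  obtain ⟨e3a⟩ := KTheory.nonempty_pullbackFreeIso (snd X V'o).left I
  -- `e3 : (X ◁ (κ ≫ uV))^* 𝓕 ≅ 𝒪^I` on `X × V'`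
  have hcomp : (X ◁ (κ ≫ uV)).left = (X ◁ κ).left ≫ (X ◁ uV).left := by
    rw [whiskerLeft_comp, Over.comp_left]
  let e3 : (Scheme.Modules.pullback (X ◁ (κ ≫ uV)).left).obj 𝓕 ≅ SheafOfModules.free I :=
    (Scheme.Modules.pullbackCongr hcomp).app 𝓕 ≪≫
      ((Scheme.Modules.pullbackComp (X ◁ κ).left (X ◁ uV).left).app 𝓕).symm ≪≫
      (Scheme.Modules.pullback (X ◁ κ).left).mapIso eV ≪≫
      (Scheme.Modules.pullbackComp (X ◁ κ).left (snd X (Over.mk (V.ι ≫ S.hom))).left).app 𝓜 ≪≫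
      (Scheme.Modules.pullbackCongr hsq).app 𝓜 ≪≫
      ((Scheme.Modules.pullbackComp (snd X V'o).left lam).app 𝓜).symm ≪≫
      (Scheme.Modules.pullback (snd X V'o).left).mapIso e2 ≪≫ e3a
  -- (4) `κ ≫ uV = ι'° ≫ u` with `ι'° : V'° ⟶ S` the inclusion, so `(X ◁ ι'°)^* ((X ◁ u)^*𝓕) ≅ 𝒪^I`
  let ι' : V'o ⟶ S := Over.homMk V'.ι rfl
  have hκu : κ ≫ uV = ι' ≫ u := by
    ext
    change lam ≫ uV.left = V'.ι ≫ u.left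
    rw [huV, ← Category.assoc, hlam]
  have hcomp' : (X ◁ ι').left ≫ (X ◁ u).left = (X ◁ (κ ≫ uV)).left := by
    rw [hκu, whiskerLeft_comp, Over.comp_left]
  let e4 : (Scheme.Modules.pullback (X ◁ ι').left).obj
      ((Scheme.Modules.pullback (X ◁ u).left).obj 𝓕) ≅ SheafOfModules.free I :=
    (Scheme.Modules.pullbackComp (X ◁ ι').left (X ◁ u).left).app 𝓕 ≪≫
      (Scheme.Modules.pullbackCongr hcomp').app 𝓕 ≪≫ e3
  -- (5) `X × V' ≅ pr_S⁻¹V'` over `(X ⊗ S).left`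
  let pr := (snd X S).left
  have sq1 : IsPullback (X ◁ ι').left (snd X V'o).left pr V'.ι := isPullback_whiskerLeft_snd_over X ι'
  have sq2 : IsPullback (pr ⁻¹ᵁ V').ι (pr ∣_ V') pr V'.ι := (isPullback_morphismRestrict pr V').flip
  let θ := sq1.isoIsPullback _ _ sq2
  have hθ : θ.inv ≫ (X ◁ ι').left = (pr ⁻¹ᵁ V').ι := sq1.isoIsPullback_inv_fst _ _ sq2
  obtain ⟨e5a⟩ := KTheory.nonempty_pullbackFreeIso θ.inv I
  -- (6) `(pr⁻¹V').ι^* ((X ◁ u)^*𝓕) ≅ 𝒪^I`, then to the over-site of `pr⁻¹V'`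
  let e5 : (Scheme.Modules.restrictFunctor (pr ⁻¹ᵁ V').ι).obj
      ((Scheme.Modules.pullback (X ◁ u).left).obj 𝓕) ≅ SheafOfModules.free I :=
    (Scheme.Modules.restrictFunctorIsoPullback (pr ⁻¹ᵁ V').ι).app _ ≪≫
      (Scheme.Modules.pullbackCongr hθ.symm).app _ ≪≫
      ((Scheme.Modules.pullbackComp θ.inv (X ◁ ι').left).app _).symm ≪≫
      (Scheme.Modules.pullback θ.inv).mapIso e4 ≪≫ e5a
  exact ⟨V', hsV', I, ε, KTheory.nonempty_overIso_of_restrictIso e5.symm⟩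

/-- **`N1cDelta` holds — «trivialised from the base» is local on the test scheme**
([MumfordAV1970] §5 Cor. 6 / §10 p. 89; [GortzWedhorn2023] Lemma 24.67): the local trivialisations
`(1 × u|_{V_s})^*𝓕 ≅ pr^*𝓜_s` give rank-one frames of `(1 × u)^*𝓕` over the preimages `pr_S⁻¹V′_s` of an
open cover of `S` (`exists_frame_over_preimage_of_trivFromBase`), whose transition functions descend along
`pr_S♯ : Γ(U, 𝒪_S) ⥲ Γ(X × U, 𝒪)` (★ `snd_app_bijective_holds`, `X` proper and geometrically integral over
`ℂ`) to a cocycle on `S`; its line bundle `𝓜` satisfies `(1 × u)^*𝓕 ≅ pr_S^*𝓜`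
(`Modules.exists_iso_pullback_of_frames_over_preimages`).
[cite: MumfordAV1970, §5 Cor. 6 and §10 (p. 89)] [cite: GortzWedhorn2023, Lemma 24.67] -/
theorem n1cDelta_holds : SeesawRelative.N1cDelta := by
  intro R _ X _ hSt W 𝓕 _ _ S u hloc
  choose V hsV hT using hloc
  have key := fun s : S.left =>
    exists_frame_over_preimage_of_trivFromBase X 𝓕 u (V s) _ rfl (hT s) s (hsV s)
  choose V' hsV' I ε hφ using key
  have φ := fun s => (hφ s).some
  obtain ⟨𝓜, h1, hq, ⟨e⟩⟩ := Modules.exists_iso_pullback_of_frames_over_preimages (snd X S).left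
    (fun U => hSt S U) ((Scheme.Modules.pullback (X ◁ u).left).obj 𝓕) V' hsV'
    ε φ
  exact ⟨𝓜, hq, h1, ⟨e.symm⟩⟩

end SeesawRelative

end Literature.AlgebraicGeometry.Motives

end
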